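import Mathlib
import Literature.Analysis.FluidPDE.Tao2016AveragedNS.ViscousSmoothingBootstrap
import Summits.NavierStokesRegularity.NavierStokesRegularity.Theorems.TaoLadderRungTwoBreakDSSWaveGeometricTails
import HarnessLib

/-!
# One-shift datum with the tails in BALLS (what a fixed point of the renormalisation map delivers) ⟹
# surviving admissible DSS wave — the a posteriori wake regularity proved in the kernel
# (cell harvest/h2-tao-ladder, seat p2; support for K1(1) = `NoSurvivingDSSOne`, stmt-NavierStokesRegularity-20205)

MODEL lattice ODEs only (Tao 2016 §4); nothing here is a statement about the Navier–Stokes equations; no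
item is closed.

WHY THIS FILE. The dictionary theorems `DSSOneShift.isDSSWave_of_quadTermDatum` (per-shell motion law) and
their `PseudoFlowOn`-packaged forms want shell bounds `‖x_{-j}‖ ≤ M_j` on the flight with a summable flight
budget AND the geometric wake clause `M_n ≤ P gⁿ`. A fixed point of p2's one-shift renormalisation map
(STAGE 2/3, harvest/h2-tao-ladder rung1/STAGE2-LEMMA.md, rung1/STAGE3-BANACH.md) does NOT come with
`M_n ≤ P gⁿ`: in window units its wake lies in a BALL `|X_{i,-n}(s)| ≤ Q βⁿ` whose ratio `β` is slightly
LARGER than the renormalisation factor `g` (the ball radii grow along the wake), and its window/top lie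
below `C_t ϱⁿ`. (It also cannot satisfy `PseudoFlowOn`'s uniform a priori clause, since the wake
amplitude `∼ gⁿ` is unbounded; the per-shell interface is the applicable one.) This module proves, in
the kernel, the A POSTERIORI WAKE REGULARITY of STAGE2-LEMMA §4 (Corollary): along a one-shift datum the
physical amplitude left behind, `p_n = g^{-n} max_i |X_{i,-n}(0)|`, obeys
`p_{n+1} ≤ p_n + τ g^{-n} R_n` with the flight rate `R_n ≤ 4 m² M_α Λ^{-n} (Q β^{n+1})²`
(`abs_quadTerm_le_of_bounds`), a geometric increment of ratio `β²/(gΛ) < 1`; hence `p_n` is bounded and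
the wake IS `O(gⁿ)` — so the ball form of the datum already yields the surviving DSS wave
(`exists_surviving_dssWave_of_quadTermBallDatum`), and for the cell's comparable circuit tables an
`InTableClass R` counter-instance shape of `NoSurvivingDSSOne` at `(R, ε₀)`
(`exists_inTableClass_surviving_dssWave_of_circuitBallDatum`), CONDITIONAL on the datum.
-/

noncomputable section

-- `Summit.NavierStokesRegularity.NavierStokesRegularity.…` is the tree's (summit = problem) namespace; the
-- duplicated component is intended, so the dupNamespace linter is silenced for this file.
set_option linter.dupNamespace false

namespace Summit.NavierStokesRegularity.NavierStokesRegularity.Theorems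

namespace DSSOneShift

open Filter Topology MeasureTheory Set
open Literature.Analysis.FluidPDE Literature.Analysis.FluidPDE.TaoCascade

variable {m : ℕ}

/-- Componentwise bounds give a bound on the Euclidean shell vector: `|X_{i,k}(t)| ≤ b` for all `i`
implies `‖x_k(t)‖ ≤ √m · b`. [folklore] -/
theorem norm_shellVec_le_sqrt_mul {X : Fin m → ℤ → ℝ → ℝ} {k : ℤ} {t b : ℝ} (hb : 0 ≤ b)
    (h : ∀ i, |X i k t| ≤ b) : ‖shellVec X k t‖ ≤ Real.sqrt m * b := by
  rw [EuclideanSpace.norm_eq]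
  have hsum : ∑ i : Fin m, ‖(shellVec X k t) i‖ ^ 2 ≤ (m : ℝ) * b ^ 2 := by
    calc ∑ i : Fin m, ‖(shellVec X k t) i‖ ^ 2 ≤ ∑ _i : Fin m, b ^ 2 := by
          refine Finset.sum_le_sum fun i _ => ?_
          rw [shellVec_apply, Real.norm_eq_abs]
          exact pow_le_pow_left₀ (abs_nonneg _) (h i) 2
      _ = (m : ℝ) * b ^ 2 := by simp
  calc Real.sqrt (∑ i, ‖(shellVec X k t) i‖ ^ 2) ≤ Real.sqrt ((m : ℝ) * b ^ 2) :=
        Real.sqrt_le_sqrt hsum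
    _ = Real.sqrt m * b := by rw [Real.sqrt_mul (Nat.cast_nonneg m), Real.sqrt_sq hb]

/-- **Flight rate bound on a wake shell from the wake ball.** If `|X_{i,-n}(s)| ≤ Q βⁿ` on `[0, τ]` for all
wake shells (`n ≥ 0`, `Q ≥ 0`, `β ≥ 1`) and `|α| ≤ M_α`, then on shell `-(j+1)` the nonlinearity obeys
`|quadTerm_{i,-(j+1)}(X)(s)| ≤ 4 m² M_α (Λ⁻¹)^{j+1} (Q β^{j+2})²` (`Λ = bigLam ε₀ ≥ 1`): the three shells it
reads are `-(j+2), -(j+1), -j`, all below `Q β^{j+2}`, and the gains are `Λ^{-(j+1)}`, `Λ^{-(j+2)} ≤ Λ^{-(j+1)}`.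
[cite: Tao2016AveragedNS, §4 Lemma 4.1 (4.8) (the main term); cell vocabulary, harvest/h2-tao-ladder rung1/STAGE2-LEMMA.md §3 Lemma 4(a)] -/
theorem abs_quadTerm_wake_le {ε₀ Mα Q β τ : ℝ} (hε : 0 < 1 + ε₀) (hΛ1 : 1 ≤ bigLam ε₀) (hMα : 0 ≤ Mα)
    {α : Fin m → Fin m → Fin m → ℤ × ℤ × ℤ → ℝ} (hα : ∀ i₁ i₂ i₃ μ, |α i₁ i₂ i₃ μ| ≤ Mα)
    {X : Fin m → ℤ → ℝ → ℝ} (hQ : 0 ≤ Q) (hβ1 : 1 ≤ β)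
    (hwake : ∀ (n : ℕ) (s : ℝ), s ∈ Icc 0 τ → ∀ i, |X i (-(n : ℤ)) s| ≤ Q * β ^ n)
    (j : ℕ) {s : ℝ} (hs : s ∈ Icc 0 τ) (i : Fin m) :
    |quadTerm ε₀ α X i (-((j : ℤ) + 1)) s| ≤
      4 * (m : ℝ) ^ 2 * Mα * ((bigLam ε₀)⁻¹) ^ (j + 1) * (Q * β ^ (j + 2)) ^ 2 := by
  set B := Q * β ^ (j + 2) with hB
  have hB0 : 0 ≤ B := mul_nonneg hQ (pow_nonneg (zero_le_one.trans hβ1) _)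
  have hmono : ∀ {a b : ℕ}, a ≤ b → Q * β ^ a ≤ Q * β ^ b := fun hab =>
    mul_le_mul_of_nonneg_left (pow_le_pow_right₀ hβ1 hab) hQ
  -- the three shell bounds
  have hm' : ∀ i', |X i' (-((j : ℤ) + 1) - 1) s| ≤ B := fun i' => by
    have h := hwake (j + 2) s hs i'
    have e : (-((j : ℤ) + 1) - 1) = -(((j + 2 : ℕ) : ℤ)) := by push_cast; ring
    rw [e]; exact h
  have h0' : ∀ i', |X i' (-((j : ℤ) + 1)) s| ≤ B := fun i' => by
    have h := hwake (j + 1) s hs i'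
    have e : (-((j : ℤ) + 1)) = -(((j + 1 : ℕ) : ℤ)) := by push_cast; ring
    rw [e]; exact h.trans (hmono (by omega))
  have hp' : ∀ i', |X i' (-((j : ℤ) + 1) + 1) s| ≤ B := fun i' => by
    have h := hwake j s hs i'
    have e : (-((j : ℤ) + 1) + 1) = -((j : ℕ) : ℤ) := by ring
    rw [e]; exact h.trans (hmono (by omega))
  have hmain := abs_quadTerm_le_of_bounds hε.le hMα hα X i (-((j : ℤ) + 1)) s hB0 hB0 hm' h0' hp'
  -- the gains as powers of `Λ⁻¹`
  have hΛpos : 0 < bigLam ε₀ := bigLam_pos (by linarith)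
  have hg1 : (1 + ε₀) ^ ((5 : ℝ) * ((-((j : ℤ) + 1) : ℤ) : ℝ) / 2) = (bigLam ε₀)⁻¹ ^ (j + 1) := by
    rw [bigLam_zpow_eq_rpow hε, show (-((j : ℤ) + 1) : ℤ) = -(((j + 1 : ℕ) : ℤ)) by push_cast; ring,
      zpow_neg, zpow_natCast, inv_pow]
  have hg2 : (1 + ε₀) ^ ((5 : ℝ) * (((-((j : ℤ) + 1) : ℤ) : ℝ) - 1) / 2) = (bigLam ε₀)⁻¹ ^ (j + 2) := by
    have := bigLam_zpow_eq_rpow hε (-((j : ℤ) + 1) - 1)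
    push_cast at this ⊢
    rw [this, show (-((j : ℤ) + 1) - 1 : ℤ) = -(((j + 2 : ℕ) : ℤ)) by push_cast; ring,
      zpow_neg, zpow_natCast, inv_pow]
  have hΛi0 : 0 ≤ (bigLam ε₀)⁻¹ := inv_nonneg.2 hΛpos.le
  have hΛi1 : (bigLam ε₀)⁻¹ ≤ 1 := inv_le_one_of_one_le₀ hΛ1
  have hpow : (bigLam ε₀)⁻¹ ^ (j + 2) ≤ (bigLam ε₀)⁻¹ ^ (j + 1) :=
    pow_le_pow_of_le_one hΛi0 hΛi1 (by omega)
  rw [hg1, hg2] at hmain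
  have hK : 0 ≤ (m : ℝ) ^ 2 * Mα := by positivity
  have hL : 0 ≤ (bigLam ε₀)⁻¹ ^ (j + 1) := pow_nonneg hΛi0 _
  calc |quadTerm ε₀ α X i (-((j : ℤ) + 1)) s|
      ≤ (m : ℝ) ^ 2 * Mα * ((bigLam ε₀)⁻¹ ^ (j + 1) * (B * B + 2 * (B * B)) +
          (bigLam ε₀)⁻¹ ^ (j + 2) * (B * B)) := hmain
    _ ≤ (m : ℝ) ^ 2 * Mα * ((bigLam ε₀)⁻¹ ^ (j + 1) * (B * B + 2 * (B * B)) +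
          (bigLam ε₀)⁻¹ ^ (j + 1) * (B * B)) := by
        gcongr
    _ = 4 * (m : ℝ) ^ 2 * Mα * (bigLam ε₀)⁻¹ ^ (j + 1) * B ^ 2 := by ring

/-- **A POSTERIORI WAKE REGULARITY along a one-shift datum.** Let `X` solve the lattice law exactly on the
flight `[0, τ]` (`τ ≥ 0`) with the one-shift relation `g X_{i,k+1}(τ) = X_{i,k}(0)` (`g > 0`), the wake in the
ball `|X_{i,-n}(s)| ≤ Q βⁿ` (`Q ≥ 0`, `β ≥ 1`), `|α| ≤ M_α`, `Λ ≥ 1`, and `r := β²/(gΛ) < 1`. Then for every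
`n ≥ 1`, every `s ∈ [0, τ]` and every mode,
`|X_{i,-n}(s)| ≤ gⁿ · (Q β / g + K r /(1 - r) + K)`, `K := 4 τ m² M_α Q² β²`:
the wake is `O(gⁿ)` although the ball only says `O(βⁿ)`. Proof: `p_n := g^{-n} max_i |X_{i,-n}(0)|`
satisfies `p_{n+1} ≤ p_n + τ g^{-n} R_n = p_n + K r^{n}` (one-shift relation + mean value inequality with
the flight rate `abs_quadTerm_wake_le`), a convergent geometric increment.
[cite: Tao2016AveragedNS, §4 Lemma 4.1 (4.8); cell vocabulary, harvest/h2-tao-ladder rung1/STAGE2-LEMMA.md §4 (Corollary, a posteriori wake regularity)] -/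
theorem abs_wake_le_of_quadTermBallDatum {ε₀ Mα Q β τ g : ℝ} (hε : 0 < 1 + ε₀) (hΛ1 : 1 ≤ bigLam ε₀)
    (hMα : 0 ≤ Mα) {α : Fin m → Fin m → Fin m → ℤ × ℤ × ℤ → ℝ} (hα : ∀ i₁ i₂ i₃ μ, |α i₁ i₂ i₃ μ| ≤ Mα)
    {X : Fin m → ℤ → ℝ → ℝ} (hτ : 0 ≤ τ) (hg : 0 < g) (hQ : 0 ≤ Q) (hβ1 : 1 ≤ β)
    (hr : β ^ 2 < g * bigLam ε₀)
    (hX : ∀ (i : Fin m) (k : ℤ) (s : ℝ), s ∈ Icc 0 τ →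
      HasDerivWithinAt (X i k) (quadTerm ε₀ α X i k s) (Icc 0 τ) s)
    (hshift : ∀ (i : Fin m) (k : ℤ), g * X i (k + 1) τ = X i k 0)
    (hwake : ∀ (n : ℕ) (s : ℝ), s ∈ Icc 0 τ → ∀ i, |X i (-(n : ℤ)) s| ≤ Q * β ^ n)
    (n : ℕ) (hn : 1 ≤ n) {s : ℝ} (hs : s ∈ Icc 0 τ) (i : Fin m) :
    |X i (-(n : ℤ)) s| ≤ g ^ n * (Q * β / g +
      4 * τ * (m : ℝ) ^ 2 * Mα * Q ^ 2 * β ^ 2 * (β ^ 2 / (g * bigLam ε₀)) /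
        (1 - β ^ 2 / (g * bigLam ε₀)) + 4 * τ * (m : ℝ) ^ 2 * Mα * Q ^ 2 * β ^ 2) := by
  have hΛpos : 0 < bigLam ε₀ := bigLam_pos (by linarith)
  set Λ := bigLam ε₀ with hΛdef
  set K : ℝ := 4 * τ * (m : ℝ) ^ 2 * Mα * Q ^ 2 * β ^ 2 with hK
  set r : ℝ := β ^ 2 / (g * Λ) with hrdef
  have hgΛ : 0 < g * Λ := mul_pos hg hΛpos
  have hr0 : 0 ≤ r := div_nonneg (sq_nonneg _) hgΛ.le
  have hr1 : r < 1 := (div_lt_one hgΛ).2 hr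
  have hK0 : 0 ≤ K := by positivity
  have h1r : 0 < 1 - r := by linarith
  -- flight rate on shell `-(j+1)` and its mean-value consequence
  have hrate : ∀ (j : ℕ) (s : ℝ), s ∈ Icc 0 τ → ∀ i,
      |quadTerm ε₀ α X i (-((j : ℤ) + 1)) s| ≤ 4 * (m : ℝ) ^ 2 * Mα * (Λ⁻¹) ^ (j + 1) * (Q * β ^ (j + 2)) ^ 2 :=
    fun j s hs i => abs_quadTerm_wake_le hε hΛ1 hMα hα hQ hβ1 hwake j hs i
  have hmvt : ∀ (j : ℕ) (i : Fin m) (s : ℝ), s ∈ Icc 0 τ →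
      |X i (-((j : ℤ) + 1)) s - X i (-((j : ℤ) + 1)) 0| ≤
        τ * (4 * (m : ℝ) ^ 2 * Mα * (Λ⁻¹) ^ (j + 1) * (Q * β ^ (j + 2)) ^ 2) := by
    intro j i s hs
    have h := Convex.norm_image_sub_le_of_norm_hasDerivWithin_le
      (f := X i (-((j : ℤ) + 1))) (f' := fun u => quadTerm ε₀ α X i (-((j : ℤ) + 1)) u)
      (s := Icc 0 τ) (fun u hu => hX i _ u hu) (fun u hu => by
        rw [Real.norm_eq_abs]; exact hrate j u hu i) (convex_Icc 0 τ)
      (left_mem_Icc.2 hτ) hs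
    rw [Real.norm_eq_abs, Real.norm_eq_abs, sub_zero, abs_of_nonneg hs.1] at h
    refine h.trans ?_
    have hC : 0 ≤ 4 * (m : ℝ) ^ 2 * Mα * (Λ⁻¹) ^ (j + 1) * (Q * β ^ (j + 2)) ^ 2 := by positivity
    calc 4 * (m : ℝ) ^ 2 * Mα * (Λ⁻¹) ^ (j + 1) * (Q * β ^ (j + 2)) ^ 2 * s
        ≤ 4 * (m : ℝ) ^ 2 * Mα * (Λ⁻¹) ^ (j + 1) * (Q * β ^ (j + 2)) ^ 2 * τ :=
          mul_le_mul_of_nonneg_left hs.2 hC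
      _ = _ := by ring
  -- the key identity: `τ g^{-(j+1)} R_{j+1} = K r · r^j`, written multiplicatively
  have hincr : ∀ j : ℕ, τ * (4 * (m : ℝ) ^ 2 * Mα * (Λ⁻¹) ^ (j + 1) * (Q * β ^ (j + 2)) ^ 2) =
      g ^ (j + 1) * (K * r * r ^ j) := by
    intro j
    have hgne : g ≠ 0 := hg.ne'
    have hΛne : Λ ≠ 0 := hΛpos.ne'
    rw [hK, hrdef, inv_pow, div_pow, mul_pow, ← pow_mul, ← pow_mul]
    field_simp
    ring
  -- induction: start values `|X_{i,-(j+1)}(0)| ≤ g^{j+1} (Qβ/g + K r (1 - r^j)/(1 - r))`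
  have hstart : ∀ j : ℕ, ∀ i, |X i (-((j : ℤ) + 1)) 0| ≤
      g ^ (j + 1) * (Q * β / g + K * r * (1 - r ^ j) / (1 - r)) := by
    intro j
    induction j with
    | zero =>
        intro i
        have h := hwake 1 0 (left_mem_Icc.2 hτ) i
        simp only [Nat.cast_one, pow_one] at h
        have e : (-((0 : ℕ) : ℤ) + 1 : ℤ) = 1 := by simp
        simp only [Nat.cast_zero, zero_add, pow_zero, sub_self, mul_zero, zero_div, add_zero, pow_one]
        rw [show (-(1 : ℤ)) = -(1 : ℤ) from rfl] at h
        calc |X i (-1) 0| ≤ Q * β := h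
          _ = g * (Q * β / g) := by field_simp
    | succ j ih =>
        intro i
        -- one-shift: `X_{i,-(j+2)}(0) = g X_{i,-(j+1)}(τ)`
        have hsh := hshift i (-((j : ℤ) + 2))
        have e1 : (-((j : ℤ) + 2) + 1 : ℤ) = -((j : ℤ) + 1) := by ring
        rw [e1] at hsh
        have e3 : (-(((j + 1 : ℕ) : ℤ) + 1) : ℤ) = -((j : ℤ) + 2) := by push_cast; ring
        rw [e3, ← hsh, abs_mul, abs_of_pos hg]
        have hτmem : τ ∈ Icc 0 τ := right_mem_Icc.2 hτ
        have hflight : |X i (-((j : ℤ) + 1)) τ| ≤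
            |X i (-((j : ℤ) + 1)) 0| + τ * (4 * (m : ℝ) ^ 2 * Mα * (Λ⁻¹) ^ (j + 1) * (Q * β ^ (j + 2)) ^ 2) := by
          have h := hmvt j i τ hτmem
          have := abs_sub_abs_le_abs_sub (X i (-((j : ℤ) + 1)) τ) (X i (-((j : ℤ) + 1)) 0)
          linarith
        rw [hincr j] at hflight
        calc g * |X i (-((j : ℤ) + 1)) τ|
            ≤ g * (g ^ (j + 1) * (Q * β / g + K * r * (1 - r ^ j) / (1 - r)) +
                g ^ (j + 1) * (K * r * r ^ j)) := by
              refine mul_le_mul_of_nonneg_left (hflight.trans ?_) hg.le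
              exact add_le_add (ih i) le_rfl
          _ = g ^ (j + 1 + 1) * (Q * β / g + K * r * (1 - r ^ (j + 1)) / (1 - r)) := by
              have h1rne : (1 - r) ≠ 0 := h1r.ne'
              field_simp
              ring
  -- uniform bound on the flight
  obtain ⟨j, rfl⟩ : ∃ j : ℕ, n = j + 1 := ⟨n - 1, by omega⟩
  have hgeo : K * r * (1 - r ^ j) / (1 - r) ≤ K * r / (1 - r) := by
    refine div_le_div_of_nonneg_right ?_ h1r.le
    have : 0 ≤ K * r * r ^ j := by positivity
    nlinarith
  have hs0 := hstart j i
  have hfl := hmvt j i s hs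
  rw [hincr j] at hfl
  have hrj : K * r * r ^ j ≤ K := by
    have hrj1 : r ^ j ≤ 1 := pow_le_one₀ hr0 hr1.le
    calc K * r * r ^ j ≤ K * 1 * 1 := by gcongr
      _ = K := by ring
  have e : (-(((j + 1 : ℕ) : ℤ)) : ℤ) = -((j : ℤ) + 1) := by push_cast; ring
  rw [e]
  have habs : |X i (-((j : ℤ) + 1)) s| ≤ |X i (-((j : ℤ) + 1)) 0| + g ^ (j + 1) * (K * r * r ^ j) := by
    have := abs_sub_abs_le_abs_sub (X i (-((j : ℤ) + 1)) s) (X i (-((j : ℤ) + 1)) 0)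
    linarith
  have hgpow : 0 ≤ g ^ (j + 1) := pow_nonneg hg.le _
  calc |X i (-((j : ℤ) + 1)) s|
      ≤ g ^ (j + 1) * (Q * β / g + K * r * (1 - r ^ j) / (1 - r)) + g ^ (j + 1) * (K * r * r ^ j) := by
        linarith [hs0]
    _ ≤ g ^ (j + 1) * (Q * β / g + K * r / (1 - r)) + g ^ (j + 1) * K := by
        gcongr
    _ = g ^ (j + 1) * (Q * β / g + K * r / (1 - r) + K) := by ring

/-- **Ball datum on one flight ⟹ non-trivial (S₁)-surviving admissible DSS wave.** Let the scalar family
`X` solve Tao's lattice law exactly on the closed flight, `∂ₜX_{i,k} = quadTerm ε₀ α X i k` on `[0, τ]`, with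
the ONE-SHIFT relation `g X_{i,k+1}(τ) = X_{i,k}(0)`, `Λ = g e^{T}`, `T > 0`, `τ = t⋆(1 - e^{-T}) > 0`,
bounded structure constants `|α| ≤ M_α`, and the TAILS IN BALLS: wake `|X_{i,-n}(s)| ≤ Q βⁿ` (`n ≥ 0`,
`β ≥ 1`, `β² < gΛ`) and window/top `|X_{i,n}(s)| ≤ C_t ϱⁿ` (`n ≥ 0`, `0 ≤ ϱ`, `ϱΛ < 1`) on `[0, τ]`. If
`1 < g² ≤ 1 + ε₀` and some `X_{i,0} ≢ 0` on `[0, τ)`, the table carries a non-trivial admissible one-profile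
DSS wave with delay `T` that is (S₁)-surviving. The geometric wake clause of the dictionary is DERIVED
(`abs_wake_le_of_quadTermBallDatum`), not assumed. This is the form in which a fixed point of the one-shift
renormalisation map on (window box) × (wake ball) × (top ball) presents itself.
[cite: Tao2016AveragedNS, §4 Lemma 4.1 (4.8), §5.3–§6; cell vocabulary (`IsDSSWave`, `Surviving`), harvest/h2-tao-ladder rung1/STAGE2-LEMMA.md §2–§4 and rung1/STAGE3-BANACH.md] -/
theorem exists_surviving_dssWave_of_quadTermBallDatum {ε₀ Mα Q β Ct ϱ τ g T tstar : ℝ}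
    (hε : 0 < 1 + ε₀) (hMα : 0 ≤ Mα) {α : Fin m → Fin m → Fin m → ℤ × ℤ × ℤ → ℝ}
    (hα : ∀ i₁ i₂ i₃ μ, |α i₁ i₂ i₃ μ| ≤ Mα) {X : Fin m → ℤ → ℝ → ℝ}
    (hg : 0 < g) (hT : 0 < T) (hlam : bigLam ε₀ = g * Real.exp T) (hτ : 0 < τ)
    (htstar : τ = tstar * (1 - Real.exp (-T)))
    (hX : ∀ (i : Fin m) (k : ℤ) (s : ℝ), s ∈ Icc 0 τ →
      HasDerivWithinAt (X i k) (quadTerm ε₀ α X i k s) (Icc 0 τ) s)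
    (hshift : ∀ (i : Fin m) (k : ℤ), g * X i (k + 1) τ = X i k 0)
    (hQ : 0 ≤ Q) (hβ1 : 1 ≤ β) (hr : β ^ 2 < g * bigLam ε₀)
    (hwake : ∀ (n : ℕ) (s : ℝ), s ∈ Icc 0 τ → ∀ i, |X i (-(n : ℤ)) s| ≤ Q * β ^ n)
    (hϱ : 0 ≤ ϱ) (hϱ1 : ϱ * bigLam ε₀ < 1)
    (htop : ∀ (n : ℕ) (s : ℝ), s ∈ Icc 0 τ → ∀ i, |X i (n : ℤ) s| ≤ Ct * ϱ ^ n)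
    (hg1 : 1 < g ^ 2) (hg2 : g ^ 2 ≤ 1 + ε₀) (hne : ∃ s ∈ Ico 0 τ, ∃ i, X i 0 s ≠ 0) :
    ∃ Φ : Unit → ℝ → Em m, IsDSSWave ε₀ α (Equiv.refl Unit) T Φ ∧ Surviving 1 ε₀ T ∧
      ∃ x, Φ () x ≠ 0 := by
  have hΛpos : 0 < bigLam ε₀ := bigLam_pos (by linarith)
  -- `g > 1` (from `g² > 1`) and `e^T > 1`, so `Λ = g e^T ≥ 1`
  have hg1' : 1 < g := by nlinarith [hg1, hg]
  have hΛ1 : 1 ≤ bigLam ε₀ := by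
    rw [hlam]
    have : 1 ≤ Real.exp T := Real.one_le_exp hT.le
    nlinarith
  have hCt : 0 ≤ Ct := by
    have h := htop 0 0 (left_mem_Icc.2 hτ.le)
    rcases isEmpty_or_nonempty (Fin m) with hm | ⟨⟨i⟩⟩
    · -- `m = 0`: the start shell cannot be non-zero
      obtain ⟨s, _, i, _⟩ := hne
      exact (IsEmpty.false i).elim
    · have := h i; simp only [Nat.cast_zero, pow_zero, mul_one] at this
      exact (abs_nonneg _).trans this
  -- the a posteriori wake constant
  set P : ℝ := Q * β / g +
      4 * τ * (m : ℝ) ^ 2 * Mα * Q ^ 2 * β ^ 2 * (β ^ 2 / (g * bigLam ε₀)) /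
        (1 - β ^ 2 / (g * bigLam ε₀)) + 4 * τ * (m : ℝ) ^ 2 * Mα * Q ^ 2 * β ^ 2 with hPdef
  have hgΛ : 0 < g * bigLam ε₀ := mul_pos hg hΛpos
  have hr0 : 0 ≤ β ^ 2 / (g * bigLam ε₀) := div_nonneg (sq_nonneg _) hgΛ.le
  have hr1 : β ^ 2 / (g * bigLam ε₀) < 1 := (div_lt_one hgΛ).2 hr
  have hP0 : 0 ≤ P := by
    have h1 : 0 ≤ Q * β / g := div_nonneg (mul_nonneg hQ (zero_le_one.trans hβ1)) hg.le
    have h2 : 0 ≤ 4 * τ * (m : ℝ) ^ 2 * Mα * Q ^ 2 * β ^ 2 := by positivity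
    have h3 : 0 ≤ 4 * τ * (m : ℝ) ^ 2 * Mα * Q ^ 2 * β ^ 2 * (β ^ 2 / (g * bigLam ε₀)) /
        (1 - β ^ 2 / (g * bigLam ε₀)) := div_nonneg (mul_nonneg h2 hr0) (by linarith)
    rw [hPdef]; linarith
  have hwakeP : ∀ (n : ℕ), 1 ≤ n → ∀ s ∈ Icc 0 τ, ∀ i, |X i (-(n : ℤ)) s| ≤ g ^ n * P :=
    fun n hn s hs i => abs_wake_le_of_quadTermBallDatum hε hΛ1 hMα hα hτ.le hg hQ hβ1 hr hX hshift
      hwake n hn hs i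
  -- the shell-bound family: `√m (P + C_t) gⁿ` on the wake (`n ≥ 1`), `√m C_t ϱⁿ` on window/top (`n ≤ 0`)
  set Cw : ℝ := Real.sqrt m * (P + Ct) with hCw
  set Ct' : ℝ := Real.sqrt m * Ct with hCt'
  let M : ℤ → ℝ := fun j => if 0 < j then Cw * g ^ j.toNat else Ct' * ϱ ^ (-j).toNat
  have hsq : 0 ≤ Real.sqrt m := Real.sqrt_nonneg _
  have hM0 : ∀ j, 0 ≤ M j := by
    intro j; simp only [M]
    split_ifs
    · exact mul_nonneg (mul_nonneg hsq (by linarith)) (pow_nonneg hg.le _)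
    · exact mul_nonneg (mul_nonneg hsq hCt) (pow_nonneg hϱ _)
  have hMnat : ∀ n : ℕ, M n ≤ Cw * g ^ n := by
    intro n; simp only [M]
    split_ifs with h
    · simp
    · have hn : n = 0 := by omega
      subst hn
      simp only [Nat.cast_zero, neg_zero, Int.toNat_zero, pow_zero, mul_one, hCt', hCw]
      exact mul_le_mul_of_nonneg_left (by linarith) hsq
  have hMneg : ∀ n : ℕ, M (-(n : ℤ)) ≤ Ct' * ϱ ^ n := by
    intro n; simp only [M]
    split_ifs with h
    · omega
    · simp
  have hM : ∀ (j : ℤ) (s : ℝ), s ∈ Icc 0 τ → ‖shellVec X (-j) s‖ ≤ M j := by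
    intro j s hs
    simp only [M]
    split_ifs with h
    · -- wake shell `-j`, `j ≥ 1`
      obtain ⟨n, rfl⟩ : ∃ n : ℕ, j = n := ⟨j.toNat, (Int.toNat_of_nonneg h.le).symm⟩
      have hn : 1 ≤ n := by exact_mod_cast h
      simp only [Int.toNat_natCast]
      have hb : ∀ i, |X i (-(n : ℤ)) s| ≤ (P + Ct) * g ^ n := fun i =>
        (hwakeP n hn s hs i).trans (by nlinarith [pow_nonneg hg.le n, hCt])
      calc ‖shellVec X (-(n : ℤ)) s‖ ≤ Real.sqrt m * ((P + Ct) * g ^ n) :=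
            norm_shellVec_le_sqrt_mul (by positivity) hb
        _ = Cw * g ^ n := by rw [hCw]; ring
    · -- window / top shell `-j = n ≥ 0`
      obtain ⟨n, hn⟩ : ∃ n : ℕ, -j = n := ⟨(-j).toNat, (Int.toNat_of_nonneg (by omega)).symm⟩
      rw [hn, Int.toNat_natCast]
      have hb : ∀ i, |X i (n : ℤ) s| ≤ Ct * ϱ ^ n := fun i => htop n s hs i
      calc ‖shellVec X (n : ℤ) s‖ ≤ Real.sqrt m * (Ct * ϱ ^ n) :=
            norm_shellVec_le_sqrt_mul (mul_nonneg hCt (pow_nonneg hϱ _)) hb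
        _ = Ct' * ϱ ^ n := by rw [hCt']; ring
  have hϱ1' : ϱ * g * Real.exp T < 1 := by rw [mul_assoc, ← hlam]; exact hϱ1
  have hsum := summable_flightBudget_of_geometric hg hT hϱ hϱ1' hM0 hMnat hMneg
  exact exists_surviving_dssWave_of_quadTermDatum hε hg hT hlam hτ htstar hX hshift hM hsum hMnat
    hg1 hg2 hne

/-- **Circuit instantiation (ball form).** An exact one-shift flow on the flight `[0, τ]` of the COMPARABLE
CIRCUIT lattice `circuitTable ρ p q gᵣ k` (positive constants, `ρ ≤ 2`, `p, q, gᵣ, k ≤ 1`, `R⁻¹ ≤` each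
half-constant), with renormalisation factor `1 < g² ≤ 1 + ε₀`, `Λ = g e^{T}`, wake ball `Q βⁿ` (`β² < gΛ`),
window/top bound `C_t ϱⁿ` (`ϱΛ < 1`) and a non-zero start shell, gives an `R`-comparable table carrying a
NON-TRIVIAL (S₁)-SURVIVING admissible DSS wave — the negation of `NoSurvivingDSSOne`'s inner statement at
`(R, ε₀)`, conditional on the datum in exactly the shape a fixed point of the one-shift map delivers.
[cite: Tao2016AveragedNS, §4 (4.1)–(4.3), §5 (circuit), §5.3–§6; cell vocabulary (`InTableClass`, `IsDSSWave`, `Surviving`), harvest/h2-tao-ladder rung1/STAGE2-LEMMA.md, rung1/STAGE3-BANACH.md] -/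
theorem exists_inTableClass_surviving_dssWave_of_circuitBallDatum {ρ p q gr k R : ℝ}
    (hρ : 0 < ρ) (hρ1 : ρ ≤ 2) (hp : 0 < p) (hp1 : p ≤ 1) (hq : 0 < q) (hq1 : q ≤ 1)
    (hgr : 0 < gr) (hgr1 : gr ≤ 1) (hk : 0 < k) (hk1 : k ≤ 1) (hRρ : R⁻¹ ≤ ρ / 2) (hRp : R⁻¹ ≤ p / 2)
    (hRq : R⁻¹ ≤ q / 2) (hRg : R⁻¹ ≤ gr / 2) (hRk : R⁻¹ ≤ k / 2)
    {ε₀ Q β Ct ϱ τ g T tstar : ℝ} {X : Fin 4 → ℤ → ℝ → ℝ}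
    (hε : 0 < 1 + ε₀) (hg : 0 < g) (hT : 0 < T) (hlam : bigLam ε₀ = g * Real.exp T) (hτ : 0 < τ)
    (htstar : τ = tstar * (1 - Real.exp (-T)))
    (hX : ∀ (i : Fin 4) (k' : ℤ) (s : ℝ), s ∈ Icc 0 τ →
      HasDerivWithinAt (X i k') (quadTerm ε₀ (circuitTable ρ p q gr k) X i k' s) (Icc 0 τ) s)
    (hshift : ∀ (i : Fin 4) (k' : ℤ), g * X i (k' + 1) τ = X i k' 0)
    (hQ : 0 ≤ Q) (hβ1 : 1 ≤ β) (hr : β ^ 2 < g * bigLam ε₀)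
    (hwake : ∀ (n : ℕ) (s : ℝ), s ∈ Icc 0 τ → ∀ i, |X i (-(n : ℤ)) s| ≤ Q * β ^ n)
    (hϱ : 0 ≤ ϱ) (hϱ1 : ϱ * bigLam ε₀ < 1)
    (htop : ∀ (n : ℕ) (s : ℝ), s ∈ Icc 0 τ → ∀ i, |X i (n : ℤ) s| ≤ Ct * ϱ ^ n)
    (hg1 : 1 < g ^ 2) (hg2 : g ^ 2 ≤ 1 + ε₀) (hne : ∃ s ∈ Ico 0 τ, ∃ i, X i 0 s ≠ 0) :
    ∃ α : Fin 4 → Fin 4 → Fin 4 → ℤ × ℤ × ℤ → ℝ, InTableClass R α ∧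
      ∃ (T' : ℝ) (Φ : Unit → ℝ → Em 4), IsDSSWave ε₀ α (Equiv.refl Unit) T' Φ ∧ Surviving 1 ε₀ T' ∧
        ∃ x, Φ () x ≠ 0 := by
  -- the circuit's structure constants are bounded by `1` in modulus (comparable on `S`, zero off `S`)
  have hα : ∀ i₁ i₂ i₃ μ, |circuitTable ρ p q gr k i₁ i₂ i₃ μ| ≤ 1 := by
    intro i₁ i₂ i₃ μ
    by_cases hμ : μ ∈ shiftSet
    · exact ((isComparableCoeff_circuitTable hρ hρ1 hp hp1 hq hq1 hgr hgr1 hk hk1 hRρ hRp hRq hRg hRk)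
        i₁ i₂ i₃ μ hμ).1
    · rw [circuitTable_eq_zero_of_not_mem ρ p q gr k i₁ i₂ i₃ μ hμ, abs_zero]; exact zero_le_one
  obtain ⟨Φ, hΦ, hS, hx⟩ := exists_surviving_dssWave_of_quadTermBallDatum hε zero_le_one hα hg hT
    hlam hτ htstar hX hshift hQ hβ1 hr hwake hϱ hϱ1 htop hg1 hg2 hne
  exact ⟨circuitTable ρ p q gr k,
    inTableClass_circuitTable hρ hρ1 hp hp1 hq hq1 hgr hgr1 hk hk1 hRρ hRp hRq hRg hRk, T, Φ, hΦ, hS, hx⟩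

end DSSOneShift

end Summit.NavierStokesRegularity.NavierStokesRegularity.Theorems
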